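import Summits.BirchSwinnertonDyer.Rank1Residual.O5.CongruenceBlockLocationAtNineRows1
import Summits.BirchSwinnertonDyer.Rank1Residual.O5.CongruenceBlockLocationAtNineRows2
import Summits.BirchSwinnertonDyer.Rank1Residual.O5.CongruenceBlockLocationAtNineRows3
import HarnessLib

/-!
# BLOCKLOC census records, assembly: the 800 rows and the census statements T-BL (o5-r2 GEN 8; typed by cc-typer-5 GEN 10)
# — DECIDABLE BOOKKEEPING, NOTHING ASSERTED

HONEST FRAMING (cell `b2b-bsdres`, run/shared/lean/b2b/bsd-rank1-residual/, verbatim in every file): the goal of the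
cell is to DELETE the COMBINATION-SHAPED residual classes of the Birch–Swinnerton-Dyer formula for ALL analytic-rank
`≤ 1` elliptic curves over `ℚ` — "full BSD formula for every rank `≤ 1` curve in class `C`" assembled STRICTLY from
published theorems — so that the rank-`≤ 1` remainder becomes exactly the CONSTRUCTION-SHAPED classes, which are TYPED
(missing-input `Prop`s), NOT attempted. This is not "finishing BSD". Lane CLASS-CLOSURE: research routes; census output
is EVIDENCE / conjecture items, never a Literature fact; nothing is booked and no mark of `RESIDUAL-MAP.md` moves.

T-BL (o5-r2 GEN 8 BLOCKLOC, result e71d445b00ed5623; schema `O5/CongruenceBlockLocationAtNine.lean`): on EVERY `3`-surjective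
(non-CM) optimal curve with `9 ∥ N ≤ 2000` of the census — 720 rows: Iₙ* 380, III 100, III* 100, I₀*-ord 84, I₀*-ss 56 —
the five block bits are the pre-registered function of (kind; classifier): P1/P1′ (Iₙ*), P2 (I₀*-ord), P3 (I₀*-ss), P4/P5 (III*),
P4/P6 (III), with ZERO exceptions; the 7 CM rows and the 73 `borel` rows are carried unscored. COMPUTATIONAL EVIDENCE; 0 facts; no node.
-/

set_option autoImplicit false

namespace Summit.BirchSwinnertonDyer.Rank1Residual.O5

open BlockRow

/-- The 800 BLOCKLOC rows (parts 1–3). [folklore] -/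
def blockRows : List BlockRow := blockRows1 ++ blockRows2 ++ blockRows3

/-- **T-BL: every `surj` row FITS** (P1, P1′, P2, P3, P4, P5, P6 by kind; bits consistent with `r`) — from the three
part theorems by `fitsAll_append`. [folklore] -/
theorem blockRows_fitsAll : BlockRow.FitsAll blockRows :=
  fitsAll_append (fitsAll_append blockRows1_fitsAll blockRows2_fitsAll) blockRows3_fitsAll

/-- Row form of T-BL. [folklore] -/
theorem blockRows_fits : ∀ ρ ∈ blockRows, ρ.Fits ∧ ρ.bitsFromR = true := fits_of_fitsAll blockRows_fitsAll

/-- Census counts: 800 rows; image classes `surj` 720 / `borel` 73 / `cm` 7. [folklore] -/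
theorem blockRows_counts : blockRows.length = 800 ∧ countImage blockRows .surj = 720 ∧
    countImage blockRows .borel = 73 ∧ countImage blockRows .cm = 7 := by
  refine ⟨?_, ?_, ?_, ?_⟩ <;> decide +kernel

/-- Scored population by kind (`surj` rows): Iₙ* 380, III 100, III* 100, I₀*-ord 84, I₀*-ss 56. [folklore] -/
theorem blockRows_countSurjKind : countSurjKind blockRows .InStar = 380 ∧ countSurjKind blockRows .III = 100 ∧
    countSurjKind blockRows .IIIstar = 100 ∧ countSurjKind blockRows .I0starOrd = 84 ∧
    countSurjKind blockRows .I0starSS = 56 := by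
  refine ⟨?_, ?_, ?_, ?_, ?_⟩ <;> decide +kernel

end Summit.BirchSwinnertonDyer.Rank1Residual.O5
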